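import Summits.BirchSwinnertonDyer.Rank1Residual.X11b.BDPRouteHalvesClass
import Literature.NumberTheory.EllipticCurves.BSDQuadraticDescentShaOddPartGeneralProofs
import HarnessLib

/-!
# Class X11b, route "BDP + converse-theorem engine + Kolyvagin": the Euler-system half on the Tamagawa atom from the two SHIMURA-CURVE links of Jetchev–Skinner–Wan §7.4.2 (cell `b2b-bsdres`, sub-cell `multr1-p2`, gen 9)

HONEST FRAMING (verbatim, cell `b2b-bsdres`): the goal of the cell is to DELETE the
COMBINATION-SHAPED residual classes for ALL analytic-rank `≤ 1` curves over `ℚ` — "full BSD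
formula for every rank `≤ 1` curve in class `C`" assembled STRICTLY from published theorems — so
that the rank-`≤ 1` remainder becomes exactly the CONSTRUCTION-SHAPED classes, which are TYPED
(missing-input Props), NOT attempted; this is not "finishing BSD". Research route `p2` for class
X11b; no claim beyond the stated class; nothing booked; X11b stays CONSTRUCTION-SHAPED. Theorems
only (no definition, no new named fact). Nothing in this file is a theorem about CM points on
Shimura curves: it is the valuation bookkeeping that pins WHICH two displayed statements the
typed input (T2) of the whole-class theorem is conditional on.

## What this file does

On the (ram) ∧ `p ∣ ∏_ℓ c_ℓ(E)` atom of X11b the route's upper half (`Typed.MissingUpperBoundAt`,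
the typed input (T2) of `bsdp_of_classX11b_five_of_typedInputs[_local]`) is missed by the
classical modular parametrisation by the Tamagawa defect `2·ord_p ∏ c_ℓ`
(`BDPRouteTamagawaDefect.lean`): over an imaginary quadratic field in which every `ℓ ∣ N` SPLITS,
Kolyvagin's index bound `ord_p #Ш(E/K) ≤ 2·ord_p [E(K):ℤP]` and the Gross–Zagier/BSD bookkeeping
`2·ord_p [E(K):ℤP] = ord_p(L'(E,1)/(Ω_E Reg_E) · L(E^D,1)/Ω_{E^D})` (`BDPRouteShaAn.lean`) meet only
when `p ∤ ∏_ℓ c_ℓ(E)`. Jetchev–Skinner–Wan 2017 §7.4.2 (arXiv:1512.06894 p. 31) remove the defect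
with a SECOND auxiliary field `K″` in which the offending primes are INERT (`N = N⁺N⁻`, `ℓ ∣ N⁻`
iff `ℓ` inert, `N⁻` square-free with an even number of prime factors — their hypothesis (H),
p. 17) and the Heegner point `z_{K″} = z^{N⁺,N⁻}_{K″} ∈ E(K″)` of the Shimura curve `X_{N⁺,N⁻}`;
their two displayed links (p. 31, verbatim) are

* (U-Sh) "From Theorem 4.4.1 we obtain `ord_p(#Ш(E/K″)[p^∞]) ≤ 2·ord_p(m_{K″})`",
  `m_{K″} = [E(K″) : ℤ·z_{K″}]` — their Thm. 4.4.1 (p. 19: "Suppose that `E[p]` is an irreducible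
  `G_ℚ`-representation. Suppose that hypothesis (H) holds for `K` and the conductor `N` of `E`. Then
  `#Ш(E/K)[p^∞] ≤ p^{2 m₀^{N⁺,N⁻}}`", "a direct consequence of [Nekovář 2007]"), printed under the
  standing hypothesis (split) `p = v v̄` in `K` (p. 17) — so `p ∣ N⁺` is allowed, `p ∣ N⁻` is not;
* (GZ-Sh) "From the Gross–Zagier formula for `z_{K″}` we have …
  `2·ord_p(m_{K″}) = ord_p(L'(E,1)/(Ω_E·Reg(E/ℚ)) · L(E^{D″},1)/Ω_{E^{D″}}) − ord_p(∏_{ℓ∣N⁻} c_ℓ(E/K″))`"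
  (Yuan–Zhang–Zhang / Cai–Shu–Tian on `X_{N⁺,N⁻}` with W. Zhang's normalisation and the
  Ribet–Takahashi degree comparison; printed there under `p ∤ N`).

This file proves, WITHOUT any Heegner hypothesis on the quadratic field `K` (inert primes
allowed) and at an ARBITRARY point `P ∈ E(K)`:

* `missingUpperBoundAt_of_shimuraShapes` — the bookkeeping core: (U-Sh) at `P` + (GZ-Sh) at `P`
  with an abstract `N⁻`-term `T : ℕ` + the `≥`-half of the rank-`0` `p`-part of the twist `E^{d_K}`
  (Skinner 2016 Thm. C shape) + the NUMERIC Tamagawa condition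
  `ord_p ∏c_ℓ(E) + ord_p ∏c_ℓ(E^{d_K}) ≤ T` ⟹ `Typed.MissingUpperBoundAt E p`. Inputs used:
  `Ш(E/K)[p^∞] ≅ Ш(E)[p^∞] ⊕ Ш(E^{d_K})[p^∞]` for odd `p` (tree theorem
  `card_primaryComponent_sha_baseChange_quadratic_of_odd_of_finite`, ANY quadratic `K`) and the
  definition of `#Ш_an` (Miller 2011). No torsion or image hypothesis is needed.
* `missingUpperBoundAt_of_shimuraShapes_of_thmC` — the same with the twist's half DISCHARGED by
  Skinner 2016 Thm. C (PUBLISHED named fact `hSk`) for an X11b pair (`r_an = 1`, `p ≥ 5`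
  multiplicative, `E[p]` irreducible) and a quadratic `K` in which `p` and ONE (ram) witness `ℓ₀`
  split (`d_K` a square in `ℚ_p` and in `ℚ_{ℓ₀}`; the other bad primes are free — in particular the
  primes `ℓ` with `p ∣ c_ℓ(E)` may be inert) with `L(E^{d_K},1) ≠ 0`; finiteness of `Ш(E)`,
  `Ш(E^{d_K})` from Gross–Zagier–Kolyvagin over `ℚ` (`hGZK`).
* `missingUpperBoundAt_of_classX11b_of_ram_of_shimuraShapes` — class-level display: on
  X11b ∧ `p ≥ 5` ∧ (ram), the typed input (T2) is implied by the existence of such `(K, P, T)`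
  carrying (U-Sh), (GZ-Sh) and the numeric Tamagawa condition. For the field of JSW §7.4.2 (the
  primes `ℓ ≠ p` with `p ∣ c_ℓ(E)` inert, everything else split) and `T = ord_p ∏_{ℓ∣N⁻} c_ℓ(E/K″)`
  the numeric condition holds exactly when `p ∤ c_p(E)`, i.e. OFF the sub-shape (T2α) "split
  multiplicative and peu ramifié at `p`" of `BDPRouteTamagawaSupport.lean` (census: (T2β)∖(T2α) =
  41 174 of the 61 998 pairs of the atom, `N < 5·10⁵`; 1 372 ‖ 2 149 in the window `N < 2·10⁴`);
  that local Tamagawa computation over `K″` (Kodaira–Néron at inert multiplicative places) is NOT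
  done here — it is the field-supply step F6/B1 of `HOME/b2b-bsdres-multr1-p2/SHIMURA-UPPER-HALF-SPEC.md`.

CONDITIONAL theorems (the two shapes are hypotheses; their printed sources at `p ∥ N` are JSW 2017
Thm. 4.4.1 — primary source Nekovář 2007, unread, acq-08433/acq-09094 — and the explicit
Gross–Zagier formula on `X_{N⁺,N⁻}` with the Ribet–Takahashi/Takahashi degree comparison); nothing
booked; labels unchanged.

## References

* [JetchevSkinnerWan2017] D. Jetchev, C. Skinner, X. Wan, Camb. J. Math. 5 (2017) = arXiv:1512.06894,
  §4.1 (H) (p. 17), Thm. 4.4.1 (p. 19), §7.4.2 (p. 31).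
* [Skinner2016PacificMC] C. Skinner, Pacific J. Math. 283 (2016), Thm. C.
* [Miller2011LMS] R. L. Miller, LMS J. Comput. Math. 14 (2011), Def. 1.1.
* the references of `BDPRouteHalvesClass.lean`, `BDPRouteTamagawaDefect.lean`.
-/

noncomputable section

open scoped Classical

open WeierstrassCurve NumberField Literature.NumberTheory.EllipticCurves
  Literature.NumberTheory.EllipticCurves.ModularForms
  Literature.NumberTheory.EllipticCurves.Rank1Residual
  Literature.NumberTheory.EllipticCurves.Rank1Residual.Typed

namespace Summit.BirchSwinnertonDyer.Rank1Residual.X11b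

/-! ### The bookkeeping core: (U-Sh) + (GZ-Sh) + the twist's `≥`-half + the numeric Tamagawa condition -/

/-- **The Euler-system half of `BSD(E,p)` from the two Shimura-curve links of
Jetchev–Skinner–Wan 2017 §7.4.2, at an arbitrary point of an arbitrary quadratic field.** Data:
`W/ℚ` elliptic, `p` an odd prime, `K` ANY quadratic field (no Heegner hypothesis: inert primes
allowed), `Wd` any model of the twist `E^{d_K}`, `Ш(E)` and `Ш(E^{d_K})` finite, `P ∈ E(K)` any
point, `T : ℕ` (the `N⁻`-term). Hypotheses (shapes, verbatim from JSW p. 31): (U-Sh)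
`#Ш(E/K)[p^∞] ≤ p^{2·ord_p [E(K):ℤP]}`; (GZ-Sh) `L^{(r)}(E,1)/(r!·Ω_E·Reg_E) = q_E ∈ ℚ^×`,
`L(E^{d_K},1)/Ω_{E^{d_K}} = q_d ∈ ℚ^×` and `2·ord_p [E(K):ℤP] + T = ord_p q_E + ord_p q_d`; the
`≥`-half of the rank-`0` `p`-part of the twist `ord_p q_d ≤ ord_p #Ш(E^d) + ord_p ∏c(E^d) − 2 ord_p #E^d(ℚ)_tors`
(Skinner 2016 Thm. C shape); and the numeric Tamagawa condition `ord_p ∏c(E) + ord_p ∏c(E^d) ≤ T`.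
CONCLUSION: `ord_p #Ш(E) ≤ ord_p #Ш(E)_an` (`Typed.MissingUpperBoundAt W p`). Arithmetic:
`v(Ш_E) + v(Ш_d) = v(#Ш(E/K)[p^∞]) ≤ 2v(I) = v(q_E) + v(q_d) − T ≤ v(q_E) + v(Ш_d) + v(c_d) − T
≤ v(q_E) + v(Ш_d) − v(c_E) ≤ v(Ш_d) + v(#Ш(E)_an)`, with `#Ш(E)_an = q_E · #E(ℚ)²_tors / ∏c(E)`.
CONDITIONAL on the shapes; nothing booked. [cite: JetchevSkinnerWan2017, §7.4.2 (p. 31) and Thm. 4.4.1 (p. 19)]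
[cite: Miller2011LMS, Def. 1.1 (arXiv:1010.2431 p. 3)] -/
theorem missingUpperBoundAt_of_shimuraShapes
    (W : WeierstrassCurve ℚ) [W.IsElliptic] (p : ℕ) [Fact p.Prime] (hp2 : p ≠ 2)
    (K : Type) [Field K] [NumberField K] (h2 : Module.finrank ℚ K = 2)
    (Wd : WeierstrassCurve ℚ) [Wd.IsElliptic]
    (hWd : ∃ C : VariableChange ℚ, C • W.quadraticTwist (NumberField.discr K : ℚ) = Wd)
    (hfinW : W.ShaFinite) (hfinD : Wd.ShaFinite)
    (P : (W.baseChange K).toAffine.Point) (T : ℕ)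
    -- the numeric Tamagawa condition (the field choice)
    (hT : padicValNat p W.tamagawaProduct + padicValNat p Wd.tamagawaProduct ≤ T)
    -- the `≥`-half of the rank-zero `p`-part for the twist (Skinner 2016 Thm. C shape)
    (htw : ∃ q : ℚ, Wd.entireLFunction 1 / (Wd.realPeriodRat : ℂ) = (q : ℂ) ∧
      padicValRat p q ≤ (padicValNat p Wd.shaOrder : ℤ) + padicValNat p Wd.tamagawaProduct -
        2 * padicValNat p Wd.torsionOrder)
    -- (GZ-Sh): the Gross–Zagier formula on `X_{N⁺,N⁻}` in BSD normalisation, with `N⁻`-term `T`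
    (hGZSh : ∃ qE qd : ℚ, qE ≠ 0 ∧ qd ≠ 0 ∧
      W.leadingLCoeff / ((W.realPeriodRat : ℂ) * (W.regulator : ℂ)) = (qE : ℂ) ∧
      Wd.entireLFunction 1 / (Wd.realPeriodRat : ℂ) = (qd : ℂ) ∧
      (2 * padicValNat p (AddSubgroup.zmultiples P).index : ℤ) + T =
        padicValRat p qE + padicValRat p qd)
    -- (U-Sh): the Kolyvagin–Nekovář bound on the Shimura curve (JSW Thm. 4.4.1 shape)
    (hUSh : Nat.card (AddCommGroup.primaryComponent (W.baseChange K).sha p) ≤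
      p ^ (2 * padicValNat p (AddSubgroup.zmultiples P).index)) :
    Typed.MissingUpperBoundAt W p := by
  have hp : p.Prime := Fact.out
  haveI : (W.baseChange K).IsElliptic := inferInstanceAs (W.map (algebraMap ℚ K)).IsElliptic
  haveI : Finite W.sha := hfinW
  haveI : Finite Wd.sha := hfinD
  haveI : Finite (AddCommGroup.primaryComponent W.sha p) :=
    Finite.of_injective _ Subtype.val_injective
  haveI : Finite (AddCommGroup.primaryComponent Wd.sha p) :=
    Finite.of_injective _ Subtype.val_injective
  ---------------------------------------------------------------- `Ш(E/K)[p^∞] = Ш(E)[p^∞] ⊕ Ш(E^d)[p^∞]`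
  have hprod := card_primaryComponent_sha_baseChange_quadratic_of_odd_of_finite W K h2 Wd hWd
    (W.baseChange K) ⟨1, one_smul _ _⟩ p hp2
  rw [card_addPrimaryComponent_eq_pow (A := ↥W.sha) p, card_addPrimaryComponent_eq_pow (A := ↥Wd.sha) p,
    ← pow_add, Nat.factorization_def _ hp, Nat.factorization_def _ hp] at hprod
  rw [hprod] at hUSh
  have e1 : padicValNat p (Nat.card W.sha) + padicValNat p (Nat.card Wd.sha) ≤
      2 * padicValNat p (AddSubgroup.zmultiples P).index :=
    (Nat.pow_le_pow_iff_right hp.one_lt).mp hUSh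
  ---------------------------------------------------------------- the rational numbers
  obtain ⟨qd', hqd', hvqd⟩ := htw
  obtain ⟨qE, qd, hqE0, hqd0, hqE, hqd, hGZ⟩ := hGZSh
  have hqq : qd' = qd := by exact_mod_cast hqd'.symm.trans hqd
  subst hqq
  ---------------------------------------------------------------- `#Ш(E)_an = q_E · t_E² / c_E`
  have hΩ : 0 < W.realPeriodRat := W.realPeriodRat_pos_holds
  have hR : 0 < W.regulator := W.regulator_pos'
  have hcW : 0 < W.tamagawaProduct := W.tamagawaProduct_pos_holds
  have htW : 0 < W.torsionOrder := W.torsionOrder_pos_holds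
  have hΩC : (W.realPeriodRat : ℂ) ≠ 0 := by exact_mod_cast hΩ.ne'
  have hRC : (W.regulator : ℂ) ≠ 0 := by exact_mod_cast hR.ne'
  have hcC : (W.tamagawaProduct : ℂ) ≠ 0 := by exact_mod_cast hcW.ne'
  have hlead : W.leadingLCoeff = (qE : ℂ) * (W.realPeriodRat : ℂ) * (W.regulator : ℂ) := by
    have := (div_eq_iff (mul_ne_zero hΩC hRC)).mp hqE
    rw [this]; ring
  set q : ℚ := qE * (W.torsionOrder : ℚ) ^ 2 / (W.tamagawaProduct : ℚ) with hq_def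
  have hsha : shaAn W = (q : ℂ) := by
    rw [shaAn_def, hlead, hq_def]
    push_cast
    field_simp
  refine ⟨q, hsha, ?_⟩
  ---------------------------------------------------------------- valuations
  have htq : (W.torsionOrder : ℚ) ≠ 0 := by exact_mod_cast htW.ne'
  have hcq : (W.tamagawaProduct : ℚ) ≠ 0 := by exact_mod_cast hcW.ne'
  have hvq : padicValRat p q = padicValRat p qE + 2 * padicValNat p W.torsionOrder -
      padicValNat p W.tamagawaProduct := by
    rw [hq_def, padicValRat.div (mul_ne_zero hqE0 (pow_ne_zero 2 htq)) hcq,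
      padicValRat.mul hqE0 (pow_ne_zero 2 htq), padicValRat.pow, padicValRat.of_nat,
      padicValRat.of_nat]
    push_cast; ring
  have e1' : (padicValNat p W.shaOrder : ℤ) + padicValNat p Wd.shaOrder ≤
      2 * padicValNat p (AddSubgroup.zmultiples P).index := by
    unfold WeierstrassCurve.shaOrder; exact_mod_cast e1
  have e4 : (padicValNat p W.tamagawaProduct : ℤ) + padicValNat p Wd.tamagawaProduct ≤ T := by
    exact_mod_cast hT
  have e5 : (0 : ℤ) ≤ padicValNat p Wd.torsionOrder := by exact_mod_cast Nat.zero_le _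
  have e6 : (0 : ℤ) ≤ padicValNat p W.torsionOrder := by exact_mod_cast Nat.zero_le _
  rw [hvq]
  omega

/-! ### The twist's half discharged by Skinner 2016 Thm. C -/

/-- **The Euler-system half on an X11b pair from the two Shimura-curve links, with the twist's
rank-`0` `p`-part supplied by Skinner 2016 Thm. C (PUBLISHED).** Data: `W/ℚ` globally minimal with
`ord_{s=1}L(E,s) = 1`, `p ≥ 5` multiplicative with `E[p]` irreducible, a (ram) witness `ℓ₀ ≠ p`
(multiplicative, `p ∤ ord_{ℓ₀} Δ_min`); a quadratic field `K` in which `d_K` is a square in `ℚ_p` and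
in `ℚ_{ℓ₀}` (i.e. `p` and `ℓ₀` split — the other bad primes, in particular the primes `ℓ` with
`p ∣ c_ℓ(E)`, are unconstrained and may be INERT) with `L(E^{d_K},1) ≠ 0`; `Wd = Cd • W^{(d_K)}`
globally minimal; `P ∈ E(K)`, `T : ℕ` with the numeric Tamagawa condition, (GZ-Sh) and (U-Sh) as in
`missingUpperBoundAt_of_shimuraShapes`. The twist is multiplicative at `p`, irreducible at `p` and has
the (ram) witness `ℓ₀` (per-prime transports along `E^{d_K} ≅ E` over `ℚ_p`, `ℚ_{ℓ₀}`:
`hasMultiplicativeReductionAtPrime_quadraticTwist_iff`, `padicValInt_minimalDiscriminantInt_twist_eq`,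
`hasIrreducibleModPGaloisRep_twist_model`), has `L(E^{d_K},1) ≠ 0` and finite `Ш` (`hGZK`), so
`hSk` gives the `≥`-half (indeed equality) of its `p`-part. CONCLUSION: `Typed.MissingUpperBoundAt W p`.
CONDITIONAL on the two shapes; nothing booked. [cite: JetchevSkinnerWan2017, §7.4.2 (p. 31) and Thm. 4.4.1 (p. 19)]
[cite: Skinner2016PacificMC, Thm. C (§1) and footnote 1] [cite: Miller2011LMS, Def. 1.1] -/
theorem missingUpperBoundAt_of_shimuraShapes_of_thmC
    -- published inputs (named facts of the tree)
    (hSk : Skinner2016.thmC_padicValRat_bsd_rank_zero)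
    (hGZK : rank_eq_analyticRank_of_analyticRank_le_one) (hmod : hasEntireLFunction_rat)
    -- the pair
    (W : WeierstrassCurve ℚ) [W.IsElliptic] [W.IsGloballyMinimal] (p : ℕ) [Fact p.Prime]
    (hp5 : 5 ≤ p) (hr : W.analyticRank = 1) (hmult : Mult W p) (hirr : Irr W p)
    {ℓ₀ : ℕ} [Fact ℓ₀.Prime] (hℓ₀ : ℓ₀ ≠ p) (hmult₀ : Mult W ℓ₀)
    (hram₀ : ¬ p ∣ padicValInt ℓ₀ W.minimalDiscriminantInt)
    -- the field: `p` and `ℓ₀` split, `L(E^{d_K},1) ≠ 0`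
    (K : Type) [Field K] [NumberField K] (h2 : Module.finrank ℚ K = 2)
    (hsqp : IsSquare (algebraMap ℚ ℚ_[p] (NumberField.discr K : ℚ)))
    (hsq₀ : IsSquare (algebraMap ℚ ℚ_[ℓ₀] (NumberField.discr K : ℚ)))
    (hLt : (W.quadraticTwist (NumberField.discr K : ℚ)).entireLFunction 1 ≠ 0)
    -- a globally minimal model of the twist
    (Wd : WeierstrassCurve ℚ) [Wd.IsElliptic] [Wd.IsGloballyMinimal] (Cd : VariableChange ℚ)
    (hWd : Cd • W.quadraticTwist (NumberField.discr K : ℚ) = Wd)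
    -- the point, the `N⁻`-term, the numeric Tamagawa condition, and the two shapes
    (P : (W.baseChange K).toAffine.Point) (T : ℕ)
    (hT : padicValNat p W.tamagawaProduct + padicValNat p Wd.tamagawaProduct ≤ T)
    (hGZSh : ∃ qE qd : ℚ, qE ≠ 0 ∧ qd ≠ 0 ∧
      W.leadingLCoeff / ((W.realPeriodRat : ℂ) * (W.regulator : ℂ)) = (qE : ℂ) ∧
      Wd.entireLFunction 1 / (Wd.realPeriodRat : ℂ) = (qd : ℂ) ∧
      (2 * padicValNat p (AddSubgroup.zmultiples P).index : ℤ) + T =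
        padicValRat p qE + padicValRat p qd)
    (hUSh : Nat.card (AddCommGroup.primaryComponent (W.baseChange K).sha p) ≤
      p ^ (2 * padicValNat p (AddSubgroup.zmultiples P).index)) :
    Typed.MissingUpperBoundAt W p := by
  have hp2 : p ≠ 2 := by omega
  have hp3 : 3 ≤ p := by omega
  have hD0 : (NumberField.discr K : ℚ) ≠ 0 := by exact_mod_cast NumberField.discr_ne_zero K
  haveI hEt : (W.quadraticTwist (NumberField.discr K : ℚ)).IsElliptic :=
    W.isElliptic_quadraticTwist hD0
  -- transports to the twist at the split primes `p` and `ℓ₀`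
  have hmultd : Wd.HasMultiplicativeReductionAtPrime p := by
    rw [← hWd, hasMultiplicativeReductionAtPrime_smul_iff]
    exact (hasMultiplicativeReductionAtPrime_quadraticTwist_iff W hD0 hsqp).mpr hmult
  have hmultd₀ : Wd.HasMultiplicativeReductionAtPrime ℓ₀ := by
    rw [← hWd, hasMultiplicativeReductionAtPrime_smul_iff]
    exact (hasMultiplicativeReductionAtPrime_quadraticTwist_iff W hD0 hsq₀).mpr hmult₀
  have hirrd : Wd.HasIrreducibleModPGaloisRep p :=
    hasIrreducibleModPGaloisRep_twist_model W p K h2 hirr Cd hWd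
  have hramd : Ram Wd p := by
    refine ⟨ℓ₀, inferInstance, hℓ₀, hmultd₀, ?_⟩
    rwa [padicValInt_minimalDiscriminantInt_twist_eq W ℓ₀ hD0 hsq₀ Cd hWd]
  -- the twist: `L(E^D,1) ≠ 0`, finiteness, Skinner's Thm. C
  have hLt' : (W.quadraticTwist (NumberField.discr K : ℚ)).entireLFunction = Wd.entireLFunction := by
    rw [← hWd, entireLFunction_smul]
  have hLd1 : Wd.entireLFunction 1 ≠ 0 := by rw [← hLt']; exact hLt
  have hrd : Wd.analyticRank = 0 := (Wd.analyticRank_eq_zero_iff_holds (hmod Wd)).2 hLd1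
  have hfinSd : Wd.ShaFinite := (hGZK Wd (by omega)).2
  have hfinW : W.ShaFinite := (hGZK W (by omega)).2
  obtain ⟨qd, hqd, hvqd⟩ := hSk Wd p hp3 (Or.inr hmultd) hirrd hramd hLd1 hfinSd
  exact missingUpperBoundAt_of_shimuraShapes W p hp2 K h2 Wd ⟨Cd, hWd⟩ hfinW hfinSd P T hT
    ⟨qd, hqd, hvqd.le⟩ hGZSh hUSh

/-! ### Class level: the typed input (T2) from the Shimura shapes -/

/-- **X11b, (ram) atom: the typed input (T2) of the whole-class theorem is implied by the two
Shimura-curve shapes.** For every X11b pair `(E,p)` with `p ≥ 5` and a (ram) prime: IF there are a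
quadratic field `K` splitting `p` and some (ram) witness `ℓ₀` with `L(E^{d_K},1) ≠ 0`, a globally
minimal model `Wd` of `E^{d_K}`, a point `P ∈ E(K)` and `T : ℕ` with the numeric Tamagawa condition
`ord_p ∏c(E) + ord_p ∏c(E^{d_K}) ≤ T`, (GZ-Sh) at `(P,T)` and (U-Sh) at `P`, THEN
`Typed.MissingUpperBoundAt E p` — from the PUBLISHED facts `hSk`, `hGZK`, `hmod` alone. For JSW's
field `K″` (§7.4.2: the primes `ℓ ≠ p` with `p ∣ c_ℓ(E)` inert, every other bad prime split) and
`T = ord_p ∏_{ℓ∣N⁻} c_ℓ(E/K″)`, the numeric condition is `p ∤ c_p(E)`: this displays (T2) OFF the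
sub-shape (T2α) as resting on exactly (U-Sh) [JSW Thm. 4.4.1, refereed; primary source Nekovář
2007] + (GZ-Sh) [YZZ/Cai–Shu–Tian + Ribet–Takahashi, at `p ∥ N`] + a Friedberg–Hoffstein field —
none of them typed in the tree yet (SPEC `HOME/b2b-bsdres-multr1-p2/SHIMURA-UPPER-HALF-SPEC.md`).
CONDITIONAL; nothing booked; X11b stays CONSTRUCTION-SHAPED.
[cite: JetchevSkinnerWan2017, §7.4.2 (p. 31) and Thm. 4.4.1 (p. 19)]
[cite: Skinner2016PacificMC, Thm. C (§1) and footnote 1] [cite: Miller2011LMS, Def. 1.1] -/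
theorem missingUpperBoundAt_of_classX11b_of_ram_of_shimuraShapes
    (hSk : Skinner2016.thmC_padicValRat_bsd_rank_zero)
    (hGZK : rank_eq_analyticRank_of_analyticRank_le_one) (hmod : hasEntireLFunction_rat)
    (W : WeierstrassCurve ℚ) [W.IsElliptic] [W.IsGloballyMinimal] (p : ℕ) [Fact p.Prime]
    (hX : ClassX11b W p) (hp5 : 5 ≤ p)
    (hSh : ∃ (ℓ₀ : ℕ) (_ : Fact ℓ₀.Prime) (K : Type) (_ : Field K) (_ : NumberField K)
        (Wd : WeierstrassCurve ℚ) (_ : Wd.IsElliptic) (_ : Wd.IsGloballyMinimal)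
        (Cd : VariableChange ℚ) (P : (W.baseChange K).toAffine.Point) (T : ℕ),
      ℓ₀ ≠ p ∧ Mult W ℓ₀ ∧ ¬ p ∣ padicValInt ℓ₀ W.minimalDiscriminantInt ∧
      Module.finrank ℚ K = 2 ∧
      IsSquare (algebraMap ℚ ℚ_[p] (NumberField.discr K : ℚ)) ∧
      IsSquare (algebraMap ℚ ℚ_[ℓ₀] (NumberField.discr K : ℚ)) ∧
      (W.quadraticTwist (NumberField.discr K : ℚ)).entireLFunction 1 ≠ 0 ∧
      Cd • W.quadraticTwist (NumberField.discr K : ℚ) = Wd ∧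
      padicValNat p W.tamagawaProduct + padicValNat p Wd.tamagawaProduct ≤ T ∧
      (∃ qE qd : ℚ, qE ≠ 0 ∧ qd ≠ 0 ∧
        W.leadingLCoeff / ((W.realPeriodRat : ℂ) * (W.regulator : ℂ)) = (qE : ℂ) ∧
        Wd.entireLFunction 1 / (Wd.realPeriodRat : ℂ) = (qd : ℂ) ∧
        (2 * padicValNat p (AddSubgroup.zmultiples P).index : ℤ) + T =
          padicValRat p qE + padicValRat p qd) ∧
      Nat.card (AddCommGroup.primaryComponent (W.baseChange K).sha p) ≤
        p ^ (2 * padicValNat p (AddSubgroup.zmultiples P).index)) :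
    Typed.MissingUpperBoundAt W p := by
  obtain ⟨hr, -, hmult, hirr⟩ := hX
  obtain ⟨ℓ₀, _, K, _, _, Wd, _, _, Cd, P, T, hℓ₀, hmult₀, hram₀, h2, hsqp, hsq₀, hLt, hWd, hT,
    hGZSh, hUSh⟩ := hSh
  exact missingUpperBoundAt_of_shimuraShapes_of_thmC hSk hGZK hmod W p hp5 hr hmult hirr hℓ₀ hmult₀
    hram₀ K h2 hsqp hsq₀ hLt Wd Cd hWd P T hT hGZSh hUSh

end Summit.BirchSwinnertonDyer.Rank1Residual.X11b

end
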